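import Literature.AnabelianGeometry.SemiGraphs.ThetaRayGraphHypotheses
import Literature.AnabelianGeometry.SemiGraphs.FreeProPRankTwoGluing
import HarnessLib

/-!
# The CONCRETE `𝒢_θ(p, n)`: the ray of free pro-`p` groups of rank 2 glued by `α` and `θ_{n_k} ∘ α`
# (FRONTIER programme «REFUTE-F1732», brick R3 piece 2)

Mochizuki, *Semi-graphs of anabelioids*, Publ. RIMS **42** (2006), Def 2.1 p. 22, Thm 3.7 (iii) p. 41
[cite: MochizukiSemiAnbd2006, Def 2.1 p.22].

abc-iut cell, L3 FRONTIER programme `plan/L3/SUBDAG-SemiAnbd-Thm37iii-REFUTE.md`, brick R3 piece 2 (seat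
abc-iut-w6-d070): the INSTANTIATION of `ProfiniteSemiGraph.thetaRayOfTwists` (`ThetaRayGraph.lean`) at brick
R1's group (abc-iut-w6-d019, `FreeProPRankTwo.lean`): vertex groups `FreeProPRankTwo.Grp p` (the pro-`p`
completion of `FreeGroup (Fin 2)`, generators `a`, `b`), edge groups `Multiplicative ℤ_[p]`, upper gluing
`α = zpow a : 1 ↦ a`, lower gluing at `e_k` `θ_{n_k} ∘ α : 1 ↦ a·b^{p^{n_k}}` — abc-iut-L3-d1's desk
countermodel object (memo `COUNTERMODEL-Thm37iii-infinite.md` §1) as a closed term of universe `0`.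
HONEST FRAMING (α59): towards a kernel erratum for the ∀-countable reading of [SemiAnbd] Thm 3.7 (iii); print
proves the finite-`𝔾` case (p431007).  This file DEFINES the object and records its branch subgroups
(`A`, `A_{n_k}`), injective type, verticial slimness and the (H1) bundle; nothing of Thm 3.7 is asserted.
No instance, no named fact; no side taken on [IUTchIII] Cor 3.12; typed ≠ proved.
-/

namespace Literature.AnabelianGeometry.SemiGraphs

namespace ProfiniteSemiGraph

open FreeProPRankTwo

variable (p : ℕ) [Fact p.Prime] (n : ℕ → ℕ)

/-- **`𝒢_θ(p, n)`** — the concrete countermodel object: `thetaRayOfTwists` at the free pro-`p` group of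
rank 2 with edge groups `ℤ_p`, upper gluings `α` and lower gluings `θ_{n_k} ∘ α` (memo §1: `n` strictly
increasing, `n_0 ≥ 1`, e.g. `n k := k + 1`). [cite: MochizukiSemiAnbd2006, Def 2.1 p.22] -/
noncomputable def thetaRayFreeProP : ProfiniteSemiGraph.{0} :=
  thetaRayOfTwists (Grp p) (Multiplicative ℤ_[p]) (α p) (fun m => θHom p m) n

/-- `𝒢_θ(p, n)` unfolds to `thetaRayOfTwists`. [cite: MochizukiSemiAnbd2006, Def 2.1 p.22] -/
theorem thetaRayFreeProP_eq : thetaRayFreeProP p n =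
    thetaRayOfTwists (Grp p) (Multiplicative ℤ_[p]) (α p) (fun m => θHom p m) n := rfl

/-- The underlying semi-graph of `𝒢_θ(p, n)` is the ray. [cite: MochizukiSemiAnbd2006, §1 p.11] -/
@[simp] theorem thetaRayFreeProP_graph : (thetaRayFreeProP p n).graph = SemiGraph.ray := rfl

/-- `𝒢_θ(p, n)` is `thetaRay` with lower gluings `θα_{n_k} = θ_{n_k} ∘ α`. [cite: MochizukiSemiAnbd2006, Def 2.1 p.22] -/
theorem thetaRayFreeProP_eq_thetaRay : thetaRayFreeProP p n =
    thetaRay (Grp p) (Multiplicative ℤ_[p]) (α p) (fun k => θα p (n k)) := rfl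

/-- The branch subgroup at `β_k⁺` (in `G_{v_{k+1}}`) is `A = α(ℤ_p) = ⟨a⟩‾`. [cite: MochizukiSemiAnbd2006, §2 p.23] -/
theorem thetaRayFreeProP_branchSubgroup_true (k v : ℕ) (h : SemiGraph.ray.abuts (k, true) = some v) :
    (thetaRayFreeProP p n).branchSubgroup (k, true) v h = A p :=
  (thetaRayOfTwists_branchSubgroup_true (Grp p) (Multiplicative ℤ_[p]) (α p) (fun m => θHom p m) n
    k v h).trans (range_α p)

/-- The branch subgroup at `β_k⁻` (in `G_{v_k}`) is `A_{n_k} = θ_{n_k}(A) = ⟨a·b^{p^{n_k}}⟩‾`.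
[cite: MochizukiSemiAnbd2006, §2 p.23] -/
theorem thetaRayFreeProP_branchSubgroup_false (k v : ℕ) (h : SemiGraph.ray.abuts (k, false) = some v) :
    (thetaRayFreeProP p n).branchSubgroup (k, false) v h = An p (n k) :=
  (thetaRay_branchSubgroup_false (Grp p) (Multiplicative ℤ_[p]) (α p) (fun k => θα p (n k))
    k v h).trans (range_θα p (n k))

/-- `𝒢_θ(p, n)` is of injective type (`α` injective, the `θ_m` automorphisms).
[cite: MochizukiSemiAnbd2006, Def 2.1 p.22] -/
theorem thetaRayFreeProP_isOfInjectiveType : (thetaRayFreeProP p n).IsOfInjectiveType :=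
  thetaRay_isOfInjectiveType _ _ _ _ (α_injective p) fun k => θα_injective p (n k)

/-- `𝒢_θ(p, n)` is verticially slim (free pro-`p` groups of rank 2 are slim, brick R1 `isSlimGroup`).
[cite: MochizukiSemiAnbd2006, Def 2.4 (ii) p.25] -/
theorem thetaRayFreeProP_isVerticiallySlim : (thetaRayFreeProP p n).IsVerticiallySlim :=
  thetaRay_isVerticiallySlim _ _ _ _ (isSlimGroup p)

/-- `𝒢_θ(p, n)` is connected. [cite: MochizukiSemiAnbd2006, Prop 3.6 p.38] -/
theorem thetaRayFreeProP_isConnected : (thetaRayFreeProP p n).IsConnected := SemiGraph.ray_isConnected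

/-- `𝒢_θ(p, n)` is countable. [cite: MochizukiSemiAnbd2006, Prop 3.6 p.38] -/
theorem thetaRayFreeProP_isCountable : (thetaRayFreeProP p n).IsCountable := SemiGraph.ray_isCountable

/-- `𝒢_θ(p, n)` has a vertex. [cite: MochizukiSemiAnbd2006, Prop 3.6 p.38] -/
theorem thetaRayFreeProP_hasVertex : (thetaRayFreeProP p n).HasVertex := SemiGraph.ray_nonempty_vertex

/-- `𝒢_θ(p, n)` is a graph of anabelioids. [cite: MochizukiSemiAnbd2006, Def 2.1 p.22] -/
theorem thetaRayFreeProP_isGraph : (thetaRayFreeProP p n).IsGraph := SemiGraph.ray_isGraph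

/-- **`Thm37Hypotheses 𝒢_θ(p, n)` assembled** from bricks R4/R5's outputs at the concrete term (named inputs)
and the facts above. [cite: MochizukiSemiAnbd2006, Thm 3.7 p.40] -/
theorem thetaRayFreeProP_thm37Hypotheses (hGC : (thetaRayFreeProP p n).IsGaloisCountable)
    (hQC : (thetaRayFreeProP p n).IsQuasiCoherent) (hTE : (thetaRayFreeProP p n).IsTotallyElevated)
    (hTA : (thetaRayFreeProP p n).IsTotallyAloof) (hTEs : (thetaRayFreeProP p n).IsTotallyEstranged) :
    (thetaRayFreeProP p n).Thm37Hypotheses :=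
  thetaRay_thm37Hypotheses _ _ _ _ (α_injective p) (fun k => θα_injective p (n k)) (isSlimGroup p)
    hGC hQC hTE hTA hTEs

end ProfiniteSemiGraph

end Literature.AnabelianGeometry.SemiGraphs
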